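import Summits.AtomisticToContinuum.Crystallization.Theses.MinMeanCycleStackingLock
import Summits.AtomisticToContinuum.Crystallization.Theorems.MinMeanCycleStackingLockLockedBoxMinimiserLayerSums

/-!
# Route `MinMeanCycleStackingLock`, item stmt-AtomisticToContinuum-12023 `LockedBoxMinimiser`

The analysis glue from the locked stacking phase to the *attained* periodic minimum of the
Lennard-Jones energy per particle:

`LockedStackingOnBox → PeriodicReductionToBarlow → BarlowEnergyIdentification (inlined) →
 HaggEnergyPeriodic → ∃ P, IsLeast (range e_LJ) (e_LJ P)`.

Proof.  For `p = (a, h)` in the relaxation box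
`B = {47/50 ≤ a ≤ 1, 39/50·a ≤ h ≤ 17/20·a}` put `J(p) = barlowCoupling lennardJones a h`,
`e₀(p) = barlowBaseEnergy lennardJones a h`, `μ(p) = ⨅_{s Hägg} haggStackingEnergy (J p) s` and
`φ = e₀ + μ`.
* `e₀` is continuous on `B` (helper file `…LockedBoxMinimiserLayerSums`, Weierstrass M-test for
  the layer sums).
* `μ` is continuous on `B`: by `LockedStackingOnBox` the infimum at `p` is attained at a PERIODIC
  Hägg sequence `w_p`, for which `HaggEnergyPeriodic` turns the `liminf` into the finite average
  `H_q(J, w_p)/q`; the finite-volume Lipschitz estimate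
  `|H_q(J, w) − H_q(J', w)| ≤ q · ∑_{k ≥ 1} |J_k − J'_k|` then gives
  `|μ(p) − μ(p₀)| ≤ ∑_{k ≥ 1} |J_k(p) − J_k(p₀)|`, which tends to `0` (Tannery, helper file).
* `B` is compact, so `φ` attains its minimum at some `p⋆`; `P := barlowPeriodicConfiguration w_{p⋆}`
  has `e(P) = φ(p⋆)` by the inlined layer identification and `HaggEnergyPeriodic`.
* For every periodic `Q`, `PeriodicReductionToBarlow` gives a box stacking `s` at some `p ∈ B` with
  `e(Q) ≥ e(P_s) = e₀(p) + haggStackingEnergy (J p) s ≥ φ(p) ≥ φ(p⋆) = e(P)`.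

No definitions are introduced (the box, `μ` and `φ` are written out).
-/

noncomputable section

open Filter Topology
open Literature.MathematicalPhysics.StatisticalMechanics
open Summit.AtomisticToContinuum.Crystallization.Theses.MinMeanCycleStackingLock
  (LockedStackingOnBox PeriodicReductionToBarlow HaggEnergyPeriodic LockedBoxMinimiser)

namespace Summit.AtomisticToContinuum.Crystallization.Theorems

namespace LockedBoxMinimiser

/-! ## The finite-volume Lipschitz estimate in the couplings -/

/-- `|∑'_{k ≥ 2} (J_k − J'_k) 1[aligned]| ≤ ∑_{k ≥ 1} |J_k − J'_k|` for summable `J, J'`. -/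
theorem abs_haggLocalEnergy_sub_le {J J' : ℕ → ℝ} (hJ : Summable J) (hJ' : Summable J')
    (s : ℤ → ℤ) (m : ℤ) :
    |haggLocalEnergy J s m - haggLocalEnergy J' s m| ≤ ∑' k : ℕ, |J (k + 1) - J' (k + 1)| := by
  have hd : Summable fun k => |J k - J' k| := (hJ.sub hJ').abs
  have hd1 : Summable fun k : ℕ => |J (k + 1) - J' (k + 1)| :=
    (summable_nat_add_iff (f := fun k => |J k - J' k|) 1).2 hd
  unfold haggLocalEnergy
  rw [← (summable_ite_of_summable hJ _).tsum_sub (summable_ite_of_summable hJ' _)]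
  set f : ℕ → ℝ := fun k => if 2 ≤ k ∧ HaggAligned s m k then J k - J' k else 0 with hf
  have heq : ∀ k, ((if 2 ≤ k ∧ HaggAligned s m k then J k else 0) -
      (if 2 ≤ k ∧ HaggAligned s m k then J' k else 0)) = f k := fun k => by
    simp only [hf]
    split_ifs <;> simp
  simp only [heq]
  have hfs : Summable f :=
    summable_ite_of_summable (J := fun k => J k - J' k) (hJ.sub hJ') _
  rw [hfs.tsum_eq_zero_add]
  have h0 : f 0 = 0 := by simp [hf]
  rw [h0, zero_add, ← Real.norm_eq_abs]
  refine tsum_of_norm_bounded hd1.hasSum fun k => ?_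
  rw [Real.norm_eq_abs]
  simp only [hf]
  split_ifs
  · exact le_rfl
  · simp

/-- **Finite-volume Lipschitz estimate**: `|H_n(J, s) − H_n(J', s)| ≤ n · ∑_{k ≥ 1} |J_k − J'_k|`. -/
theorem abs_haggEnergy_sub_le {J J' : ℕ → ℝ} (hJ : Summable J) (hJ' : Summable J')
    (s : ℤ → ℤ) (n : ℕ) :
    |haggEnergy n J s - haggEnergy n J' s| ≤ n * ∑' k : ℕ, |J (k + 1) - J' (k + 1)| := by
  unfold haggEnergy
  rw [← Finset.sum_sub_distrib]
  calc |∑ m ∈ Finset.range n, (haggLocalEnergy J s m - haggLocalEnergy J' s m)|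
      ≤ ∑ m ∈ Finset.range n, |haggLocalEnergy J s m - haggLocalEnergy J' s m| :=
        Finset.abs_sum_le_sum_abs _ _
    _ ≤ ∑ _m ∈ Finset.range n, ∑' k : ℕ, |J (k + 1) - J' (k + 1)| :=
        Finset.sum_le_sum fun m _ => abs_haggLocalEnergy_sub_le hJ hJ' s m
    _ = n * ∑' k : ℕ, |J (k + 1) - J' (k + 1)| := by simp

/-! ## The relaxation box `B = {47/50 ≤ a ≤ 1, 39/50·a ≤ h ≤ 17/20·a}` -/

/-- The box is compact. -/
theorem isCompact_box : IsCompact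
    {p : ℝ × ℝ | 47 / 50 ≤ p.1 ∧ p.1 ≤ 1 ∧ 39 / 50 * p.1 ≤ p.2 ∧ p.2 ≤ 17 / 20 * p.1} := by
  have hc : IsClosed
      {p : ℝ × ℝ | 47 / 50 ≤ p.1 ∧ p.1 ≤ 1 ∧ 39 / 50 * p.1 ≤ p.2 ∧ p.2 ≤ 17 / 20 * p.1} := by
    have e : {p : ℝ × ℝ | 47 / 50 ≤ p.1 ∧ p.1 ≤ 1 ∧ 39 / 50 * p.1 ≤ p.2 ∧ p.2 ≤ 17 / 20 * p.1} =
        {p : ℝ × ℝ | 47 / 50 ≤ p.1} ∩ {p | p.1 ≤ 1} ∩ {p | 39 / 50 * p.1 ≤ p.2} ∩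
        {p | p.2 ≤ 17 / 20 * p.1} := by
      ext p
      simp only [Set.mem_setOf_eq, Set.mem_inter_iff]
      tauto
    rw [e]
    refine ((IsClosed.inter ?_ ?_).inter ?_).inter ?_
    · exact isClosed_le continuous_const continuous_fst
    · exact isClosed_le continuous_fst continuous_const
    · exact isClosed_le (continuous_const.mul continuous_fst) continuous_snd
    · exact isClosed_le continuous_snd (continuous_const.mul continuous_fst)
  refine (isCompact_Icc.prod isCompact_Icc :
    IsCompact (Set.Icc (47 / 50 : ℝ) 1 ×ˢ Set.Icc (0 : ℝ) 1)).of_isClosed_subset hc ?_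
  intro p hp
  obtain ⟨h1, h2, h3, h4⟩ := hp
  exact ⟨⟨h1, h2⟩, ⟨by nlinarith, by nlinarith⟩⟩

/-- The box lies in the quadrant `a ≥ 47/50`, `h ≥ 1833/2500`. -/
theorem box_subset_quad :
    {p : ℝ × ℝ | 47 / 50 ≤ p.1 ∧ p.1 ≤ 1 ∧ 39 / 50 * p.1 ≤ p.2 ∧ p.2 ≤ 17 / 20 * p.1} ⊆
      Set.Ici (47 / 50 : ℝ) ×ˢ Set.Ici (1833 / 2500 : ℝ) := by
  intro p hp
  obtain ⟨h1, _, h3, _⟩ := hp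
  exact ⟨Set.mem_Ici.2 h1, Set.mem_Ici.2 (by nlinarith)⟩

/-- Points of the box have positive coordinates. -/
theorem pos_of_mem_box {p : ℝ × ℝ}
    (hp : p ∈ {p : ℝ × ℝ | 47 / 50 ≤ p.1 ∧ p.1 ≤ 1 ∧ 39 / 50 * p.1 ≤ p.2 ∧ p.2 ≤ 17 / 20 * p.1}) :
    0 < p.1 ∧ 0 < p.2 := by
  obtain ⟨h1, _, h3, _⟩ := hp
  exact ⟨by linarith, by nlinarith⟩

/-! ## The minimal stacking energy `μ(a,h) = ⨅_{s Hägg} haggStackingEnergy (J(a,h)) s` -/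

/-- One-sided estimate `μ(p₀) − ∑_{k ≥ 1} |J_k(p) − J_k(p₀)| ≤ μ(p)` on the box, from the locked
phase (periodic minimisers) and `HaggEnergyPeriodic`. -/
theorem iInf_sub_le_iInf (hLock : LockedStackingOnBox) (hHEP : HaggEnergyPeriodic) {p p₀ : ℝ × ℝ}
    (hp : p ∈ {p : ℝ × ℝ | 47 / 50 ≤ p.1 ∧ p.1 ≤ 1 ∧ 39 / 50 * p.1 ≤ p.2 ∧ p.2 ≤ 17 / 20 * p.1})
    (hp₀ : p₀ ∈ {p : ℝ × ℝ | 47 / 50 ≤ p.1 ∧ p.1 ≤ 1 ∧ 39 / 50 * p.1 ≤ p.2 ∧ p.2 ≤ 17 / 20 * p.1}) :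
    (⨅ s : {s : ℤ → ℤ // IsHaggSeq s},
        haggStackingEnergy (barlowCoupling lennardJones p₀.1 p₀.2) s.1) -
      ∑' k : ℕ, |barlowCoupling lennardJones p.1 p.2 (k + 1) -
        barlowCoupling lennardJones p₀.1 p₀.2 (k + 1)| ≤
      ⨅ s : {s : ℤ → ℤ // IsHaggSeq s},
        haggStackingEnergy (barlowCoupling lennardJones p.1 p.2) s.1 := by
  obtain ⟨-, w, q, hq, hw, hwH, hleast⟩ := hLock p.1 p.2 hp.1 hp.2.1 hp.2.2.1 hp.2.2.2
  obtain ⟨-, w₀, q₀, -, -, -, hleast₀⟩ := hLock p₀.1 p₀.2 hp₀.1 hp₀.2.1 hp₀.2.2.1 hp₀.2.2.2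
  have hJ : Summable (barlowCoupling lennardJones p.1 p.2) :=
    summable_barlowCoupling (pos_of_mem_box hp).1 (pos_of_mem_box hp).2
  have hJ₀ : Summable (barlowCoupling lennardJones p₀.1 p₀.2) :=
    summable_barlowCoupling (pos_of_mem_box hp₀).1 (pos_of_mem_box hp₀).2
  set D := ∑' k : ℕ, |barlowCoupling lennardJones p.1 p.2 (k + 1) -
      barlowCoupling lennardJones p₀.1 p₀.2 (k + 1)| with hD
  have hμ : (⨅ s : {s : ℤ → ℤ // IsHaggSeq s},
      haggStackingEnergy (barlowCoupling lennardJones p.1 p.2) s.1) =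
      haggStackingEnergy (barlowCoupling lennardJones p.1 p.2) w := hleast.csInf_eq
  have hμ₀ : (⨅ s : {s : ℤ → ℤ // IsHaggSeq s},
      haggStackingEnergy (barlowCoupling lennardJones p₀.1 p₀.2) s.1) =
      haggStackingEnergy (barlowCoupling lennardJones p₀.1 p₀.2) w₀ := hleast₀.csInf_eq
  have h1 : haggStackingEnergy (barlowCoupling lennardJones p.1 p.2) w =
      haggEnergy q (barlowCoupling lennardJones p.1 p.2) w / q := hHEP _ _ _ hJ hq hw
  have h2 : haggStackingEnergy (barlowCoupling lennardJones p₀.1 p₀.2) w =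
      haggEnergy q (barlowCoupling lennardJones p₀.1 p₀.2) w / q := hHEP _ _ _ hJ₀ hq hw
  have h3 : haggStackingEnergy (barlowCoupling lennardJones p₀.1 p₀.2) w₀ ≤
      haggStackingEnergy (barlowCoupling lennardJones p₀.1 p₀.2) w := hleast₀.2 ⟨⟨w, hwH⟩, rfl⟩
  have h4 := abs_haggEnergy_sub_le hJ hJ₀ w q
  have hq' : (0 : ℝ) < q := by exact_mod_cast hq
  have h5 : haggEnergy q (barlowCoupling lennardJones p₀.1 p₀.2) w / q - D ≤
      haggEnergy q (barlowCoupling lennardJones p.1 p.2) w / q := by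
    rw [div_sub' (ne_of_gt hq'), div_le_div_iff_of_pos_right hq']
    have := (abs_le.1 h4).1
    linarith
  rw [hμ, hμ₀, h1]
  linarith

/-- `μ` is continuous on the box. -/
theorem continuousOn_iInf (hLock : LockedStackingOnBox) (hHEP : HaggEnergyPeriodic) :
    ContinuousOn (fun p : ℝ × ℝ => ⨅ s : {s : ℤ → ℤ // IsHaggSeq s},
        haggStackingEnergy (barlowCoupling lennardJones p.1 p.2) s.1)
      {p : ℝ × ℝ | 47 / 50 ≤ p.1 ∧ p.1 ≤ 1 ∧ 39 / 50 * p.1 ≤ p.2 ∧ p.2 ≤ 17 / 20 * p.1} := by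
  intro p₀ hp₀
  have hq₁ : (0 : ℝ) < 47 / 50 := by norm_num
  have hq₂ : (0 : ℝ) < 1833 / 2500 := by norm_num
  have hD := (tendsto_tsum_abs_barlowCoupling_sub hq₁ hq₂ (box_subset_quad hp₀)).mono_left
    (nhdsWithin_mono _ box_subset_quad)
  rw [ContinuousWithinAt, tendsto_iff_norm_sub_tendsto_zero]
  refine squeeze_zero' (Eventually.of_forall fun _ => norm_nonneg _) ?_ hD
  filter_upwards [self_mem_nhdsWithin] with p hp
  rw [Real.norm_eq_abs, abs_sub_le_iff]
  constructor
  · have h := iInf_sub_le_iInf hLock hHEP hp₀ hp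
    have e : ∑' k : ℕ, |barlowCoupling lennardJones p₀.1 p₀.2 (k + 1) -
        barlowCoupling lennardJones p.1 p.2 (k + 1)| =
        ∑' k : ℕ, |barlowCoupling lennardJones p.1 p.2 (k + 1) -
        barlowCoupling lennardJones p₀.1 p₀.2 (k + 1)| :=
      tsum_congr fun k => abs_sub_comm _ _
    rw [e] at h
    linarith
  · have h := iInf_sub_le_iInf hLock hHEP hp hp₀
    linarith

/-- `φ = e₀ + μ` is continuous on the box. -/
theorem continuousOn_phi (hLock : LockedStackingOnBox) (hHEP : HaggEnergyPeriodic) :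
    ContinuousOn (fun p : ℝ × ℝ => barlowBaseEnergy lennardJones p.1 p.2 +
        ⨅ s : {s : ℤ → ℤ // IsHaggSeq s},
          haggStackingEnergy (barlowCoupling lennardJones p.1 p.2) s.1)
      {p : ℝ × ℝ | 47 / 50 ≤ p.1 ∧ p.1 ≤ 1 ∧ 39 / 50 * p.1 ≤ p.2 ∧ p.2 ≤ 17 / 20 * p.1} := by
  have hq₁ : (0 : ℝ) < 47 / 50 := by norm_num
  have hq₂ : (0 : ℝ) < 1833 / 2500 := by norm_num
  exact ((continuousOn_barlowBaseEnergy hq₁ hq₂).mono box_subset_quad).add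
    (continuousOn_iInf hLock hHEP)

end LockedBoxMinimiser

open LockedBoxMinimiser

/-- **Item stmt-AtomisticToContinuum-12023** (`LockedBoxMinimiser`, route
`MinMeanCycleStackingLock`): the locked stacking phase on the box, the periodic reduction to
Barlow stackings, the layer identification of the energy and the periodic-average formula for the
stacking energy density together give a periodic configuration of `ℝ³` MINIMISING the
Lennard-Jones energy per particle among all periodic configurations. -/
theorem lockedBoxMinimiser_proof : LockedBoxMinimiser := by
  intro hLock hRed hBEI hHEP
  -- the continuous function `φ = e₀ + μ` attains its minimum on the compact box
  have hne : ((1 : ℝ), (4 / 5 : ℝ)) ∈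
      {p : ℝ × ℝ | 47 / 50 ≤ p.1 ∧ p.1 ≤ 1 ∧ 39 / 50 * p.1 ≤ p.2 ∧ p.2 ≤ 17 / 20 * p.1} := by
    simp only [Set.mem_setOf_eq]
    norm_num
  obtain ⟨pm, hpm, hmin⟩ :=
    isCompact_box.exists_isMinOn ⟨_, hne⟩ (continuousOn_phi hLock hHEP)
  obtain ⟨-, w, q, hq, hw, hwH, hleast⟩ := hLock pm.1 pm.2 hpm.1 hpm.2.1 hpm.2.2.1 hpm.2.2.2
  have hpos := pos_of_mem_box hpm
  have ha : pm.1 ≠ 0 := hpos.1.ne'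
  have hh : pm.2 ≠ 0 := hpos.2.ne'
  have hq' : q ≠ 0 := Nat.pos_iff_ne_zero.1 hq
  refine ⟨barlowPeriodicConfiguration w ha hh hq' hw, ⟨_, rfl⟩, ?_⟩
  rintro _ ⟨Q, rfl⟩
  -- `e(P) = φ(p⋆)`
  have hJ : Summable (barlowCoupling lennardJones pm.1 pm.2) :=
    summable_barlowCoupling hpos.1 hpos.2
  have eP : (barlowPeriodicConfiguration w ha hh hq' hw).energyPerParticle lennardJones =
      barlowBaseEnergy lennardJones pm.1 pm.2 + ⨅ s : {s : ℤ → ℤ // IsHaggSeq s},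
        haggStackingEnergy (barlowCoupling lennardJones pm.1 pm.2) s.1 := by
    rw [hBEI pm.1 pm.2 hpos.1 hpos.2 w q ha hh hq' hw hwH, ← hHEP _ _ _ hJ hq hw]
    congr 1
    exact (hleast.csInf_eq).symm
  -- the reduction of `Q` to a box stacking
  obtain ⟨a, h, h1, h2, h3, h4, s, q₂, ha₂, hh₂, hq₂, hs₂, hsH, hle⟩ := hRed Q
  have hb : ((a, h) : ℝ × ℝ) ∈
      {p : ℝ × ℝ | 47 / 50 ≤ p.1 ∧ p.1 ≤ 1 ∧ 39 / 50 * p.1 ≤ p.2 ∧ p.2 ≤ 17 / 20 * p.1} :=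
    ⟨h1, h2, h3, h4⟩
  have hpos₂ : 0 < a ∧ 0 < h := pos_of_mem_box hb
  obtain ⟨-, w₂, q₃, -, -, -, hleast₂⟩ := hLock a h h1 h2 h3 h4
  have hJ₂ : Summable (barlowCoupling lennardJones a h) := summable_barlowCoupling hpos₂.1 hpos₂.2
  have eS : (barlowPeriodicConfiguration s ha₂ hh₂ hq₂ hs₂).energyPerParticle lennardJones =
      barlowBaseEnergy lennardJones a h + haggStackingEnergy (barlowCoupling lennardJones a h) s := by
    rw [hBEI a h hpos₂.1 hpos₂.2 s q₂ ha₂ hh₂ hq₂ hs₂ hsH,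
      ← hHEP _ _ _ hJ₂ (Nat.pos_iff_ne_zero.2 hq₂) hs₂]
  have hμ : (⨅ s : {s : ℤ → ℤ // IsHaggSeq s},
      haggStackingEnergy (barlowCoupling lennardJones a h) s.1) ≤
      haggStackingEnergy (barlowCoupling lennardJones a h) s :=
    ciInf_le hleast₂.bddBelow ⟨s, hsH⟩
  have hφ := (isMinOn_iff.1 hmin) _ hb
  simp only at hφ
  calc (barlowPeriodicConfiguration w ha hh hq' hw).energyPerParticle lennardJones
      = barlowBaseEnergy lennardJones pm.1 pm.2 + ⨅ s : {s : ℤ → ℤ // IsHaggSeq s},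
          haggStackingEnergy (barlowCoupling lennardJones pm.1 pm.2) s.1 := eP
    _ ≤ barlowBaseEnergy lennardJones a h + ⨅ s : {s : ℤ → ℤ // IsHaggSeq s},
          haggStackingEnergy (barlowCoupling lennardJones a h) s.1 := hφ
    _ ≤ (barlowPeriodicConfiguration s ha₂ hh₂ hq₂ hs₂).energyPerParticle lennardJones := by
        rw [eS]
        exact add_le_add le_rfl hμ
    _ ≤ Q.energyPerParticle lennardJones := hle

end Summit.AtomisticToContinuum.Crystallization.Theorems

end
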